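import Summits.KontsevichZagierPeriods.KontsevichZagierPeriods.Theorems.SoloInformedAlgLocalLeaves
import Mathlib.Algebra.Polynomial.Roots
import HarnessLib

/-!
# The DEN-calculus over `K`: stripping monomial factors, edge polynomials, isolated vertex zeros

Solo programme `solo-KontsevichZagierPeriods-informed`, session s107, step (x-f) of the general
two-dimensional algorithm: the algebra that feeds VERTEX-LOCAL
(`soloInformed_locallyPresentableDenK_zero_of_germs`).

* `soloInformedMinExpK Q` — the least exponent `m` (coordinatewise minimum over the support);
  `soloInformedStripK Q m = Q / x^m`, with `x^m · strip = Q` (`soloInformed_monomial_mul_stripK`)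
  and `coeff e' (strip) = coeff (e' + m) Q`;
* `soloInformedEdgePolyK i R ∈ K[t]` — the restriction of `R` to the `i`-th coordinate axis
  (`t ↦ R(t eᵢ)`), with `coeff k = coeff (k eᵢ) R`; it is non-zero for the stripped polynomial in
  two variables (`soloInformed_edgePolyK_stripK_ne_zero`), so `R` has FINITELY many zeros on each
  axis (`soloInformed_finite_axisZerosK`);
* **isolated vertex zero** `soloInformed_stripK_isolated_zero` — in two variables, if `Q ≠ 0`
  has no zero on the open square then its stripped part `R = Q/x^m` has no zero `y ≠ 0` in the
  closed square near the vertex `0`.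

References: M. Kontsevich, D. Zagier, *Periods* (2001), §1.2; J. Kollár, *Lectures on Resolution
of Singularities* (2007), §1.8.
-/

noncomputable section

open scoped BigOperators
open MeasureTheory Set
open Literature.NumberTheory.Transcendental Literature.NumberTheory.Transcendental.KZ

namespace Summit.KontsevichZagierPeriods.KontsevichZagierPeriods.Theorems

variable {n : ℕ} {K : Type*} [Field K] [Algebra K ℝ]

/-! ### The least exponent and the stripped polynomial -/

/-- The **least exponent** of `Q`: `mᵢ = min {eᵢ : e ∈ supp Q}` (`0` for `Q = 0`). [this work] -/
def soloInformedMinExpK (Q : MvPolynomial (Fin n) K) : Fin n →₀ ℕ :=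
  Finsupp.equivFunOnFinite.symm fun i =>
    if h : Q.support.Nonempty then Q.support.inf' h (fun e => e i) else 0

omit [Algebra K ℝ] in
/-- The coordinates of the least exponent (`Q ≠ 0`). [this work] -/
theorem soloInformed_minExpK_apply {Q : MvPolynomial (Fin n) K} (hQ : Q.support.Nonempty)
    (i : Fin n) : soloInformedMinExpK Q i = Q.support.inf' hQ (fun e => e i) := by
  show (if h : Q.support.Nonempty then Q.support.inf' h (fun e => e i) else 0) = _
  rw [dif_pos hQ]

omit [Algebra K ℝ] in
/-- The least exponent is below every exponent of the support. [this work] -/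
theorem soloInformed_minExpK_le {Q : MvPolynomial (Fin n) K} {e : Fin n →₀ ℕ}
    (he : e ∈ Q.support) : soloInformedMinExpK Q ≤ e := fun i => by
  rw [soloInformed_minExpK_apply ⟨e, he⟩]
  exact Finset.inf'_le (fun e : Fin n →₀ ℕ => e i) he

omit [Algebra K ℝ] in
/-- Each coordinate of the least exponent is attained on the support (`Q ≠ 0`). [this work] -/
theorem soloInformed_exists_minExpK_eq {Q : MvPolynomial (Fin n) K} (hQ : Q ≠ 0) (i : Fin n) :
    ∃ e ∈ Q.support, e i = soloInformedMinExpK Q i := by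
  have hne : Q.support.Nonempty := MvPolynomial.support_nonempty.2 hQ
  obtain ⟨e, he, h⟩ := Finset.exists_mem_eq_inf' hne fun e : Fin n →₀ ℕ => e i
  exact ⟨e, he, by rw [soloInformed_minExpK_apply hne, h]⟩

/-- The **stripped polynomial** `Q / x^m` (meaningful when `x^m` divides every monomial of `Q`).
[this work] -/
def soloInformedStripK (Q : MvPolynomial (Fin n) K) (m : Fin n →₀ ℕ) : MvPolynomial (Fin n) K :=
  ∑ e ∈ Q.support, MvPolynomial.monomial (e - m) (MvPolynomial.coeff e Q)

omit [Algebra K ℝ] in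
/-- `x^m · (Q / x^m) = Q` when `m` is below every exponent of `Q`. [this work] -/
theorem soloInformed_monomial_mul_stripK (Q : MvPolynomial (Fin n) K) {m : Fin n →₀ ℕ}
    (hm : ∀ e ∈ Q.support, m ≤ e) :
    MvPolynomial.monomial m (1 : K) * soloInformedStripK Q m = Q := by
  unfold soloInformedStripK
  rw [Finset.mul_sum]
  conv_rhs => rw [Q.as_sum]
  refine Finset.sum_congr rfl fun e he => ?_
  rw [MvPolynomial.monomial_mul, one_mul, add_tsub_cancel_of_le (hm e he)]

/-- Values: `Q(x) = x^m · (Q/x^m)(x)`. [this work] -/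
theorem soloInformed_aeval_eq_monomial_mul_stripK (Q : MvPolynomial (Fin n) K) {m : Fin n →₀ ℕ}
    (hm : ∀ e ∈ Q.support, m ≤ e) (x : Fin n → ℝ) :
    (MvPolynomial.aeval x Q : ℝ) = (∏ i, x i ^ m i) * MvPolynomial.aeval x (soloInformedStripK Q m) := by
  conv_lhs => rw [← soloInformed_monomial_mul_stripK Q hm]
  rw [map_mul, MvPolynomial.aeval_monomial, map_one, one_mul,
    Finsupp.prod_fintype _ _ fun i => pow_zero _]

omit [Algebra K ℝ] in
/-- Coefficients of the stripped polynomial: `coeff e' (Q/x^m) = coeff (e' + m) Q`. [this work] -/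
theorem soloInformed_coeff_stripK (Q : MvPolynomial (Fin n) K) {m : Fin n →₀ ℕ}
    (hm : ∀ e ∈ Q.support, m ≤ e) (e' : Fin n →₀ ℕ) :
    MvPolynomial.coeff e' (soloInformedStripK Q m) = MvPolynomial.coeff (e' + m) Q := by
  classical
  unfold soloInformedStripK
  rw [MvPolynomial.coeff_sum]
  simp only [MvPolynomial.coeff_monomial]
  have hiff : ∀ e ∈ Q.support, (e - m = e' ↔ e = e' + m) := fun e he =>
    ⟨fun h => by rw [← h, tsub_add_cancel_of_le (hm e he)],
      fun h => by rw [h, add_tsub_cancel_right]⟩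
  rw [Finset.sum_congr rfl fun e he => by rw [if_congr (hiff e he) rfl rfl],
    Finset.sum_ite_eq']
  split_ifs with h
  · rfl
  · exact (MvPolynomial.notMem_support_iff.1 h).symm

omit [Algebra K ℝ] in
/-- The stripped polynomial of `Q ≠ 0` by its least exponent has, for each `i`, a support element
with vanishing `i`-th coordinate (it is not divisible by `xᵢ`). [this work] -/
theorem soloInformed_exists_support_stripK_zero {Q : MvPolynomial (Fin n) K} (hQ : Q ≠ 0)
    (i : Fin n) :
    ∃ e' ∈ (soloInformedStripK Q (soloInformedMinExpK Q)).support, e' i = 0 := by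
  obtain ⟨e, he, hei⟩ := soloInformed_exists_minExpK_eq hQ i
  refine ⟨e - soloInformedMinExpK Q, ?_, ?_⟩
  · rw [MvPolynomial.mem_support_iff, soloInformed_coeff_stripK Q
      (fun e he => soloInformed_minExpK_le he), tsub_add_cancel_of_le (soloInformed_minExpK_le he)]
    exact MvPolynomial.mem_support_iff.1 he
  · show e i - soloInformedMinExpK Q i = 0
    rw [hei, Nat.sub_self]

/-- The stripped part of `Q` has no zero where `Q` has none. [this work] -/
theorem soloInformed_aeval_stripK_ne_zero (Q : MvPolynomial (Fin n) K) {m : Fin n →₀ ℕ}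
    (hm : ∀ e ∈ Q.support, m ≤ e) {x : Fin n → ℝ} (hx : (MvPolynomial.aeval x Q : ℝ) ≠ 0) :
    (MvPolynomial.aeval x (soloInformedStripK Q m) : ℝ) ≠ 0 := by
  rw [soloInformed_aeval_eq_monomial_mul_stripK Q hm] at hx
  exact right_ne_zero_of_mul hx

/-! ### Edge (axis) polynomials -/

/-- The **axis polynomial** `t ↦ R(t eᵢ)` of `R` along the `i`-th coordinate axis, as a
polynomial in `K[t]`. [this work] -/
def soloInformedEdgePolyK (i : Fin n) (R : MvPolynomial (Fin n) K) : Polynomial K :=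
  MvPolynomial.aeval (fun j => if j = i then Polynomial.X else 0) R

/-- Evaluation of the axis polynomial. [this work] -/
theorem soloInformed_aeval_edgePolyK (i : Fin n) (R : MvPolynomial (Fin n) K) (t : ℝ) :
    Polynomial.aeval t (soloInformedEdgePolyK i R) =
      (MvPolynomial.aeval (fun j => if j = i then t else (0 : ℝ)) R : ℝ) := by
  unfold soloInformedEdgePolyK
  rw [← AlgHom.comp_apply, MvPolynomial.comp_aeval]
  have hfun : (fun j => Polynomial.aeval t (if j = i then Polynomial.X else (0 : Polynomial K)))
      = fun j => if j = i then t else (0 : ℝ) := by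
    funext j
    split_ifs
    · exact Polynomial.aeval_X t
    · exact map_zero _
  rw [hfun]

omit [Algebra K ℝ] in
/-- The axis substitution on monomials. [this work] -/
theorem soloInformed_edgePolyK_monomial (i : Fin n) (a : Fin n →₀ ℕ) (c : K) :
    soloInformedEdgePolyK i (MvPolynomial.monomial a c) =
      if (∀ j, j ≠ i → a j = 0) then Polynomial.C c * Polynomial.X ^ a i else 0 := by
  classical
  unfold soloInformedEdgePolyK
  rw [MvPolynomial.aeval_monomial, Finsupp.prod_fintype _ _ fun j => pow_zero _,
    Polynomial.algebraMap_eq]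
  split_ifs with h
  · rw [Finset.prod_eq_single i (fun j _ hj => by rw [if_neg hj, h j hj, pow_zero])
      (fun hi => absurd (Finset.mem_univ i) hi), if_pos rfl]
  · push Not at h
    obtain ⟨j, hj, hja⟩ := h
    rw [Finset.prod_eq_zero (Finset.mem_univ j) (by rw [if_neg hj, zero_pow hja]), mul_zero]

omit [Algebra K ℝ] in
/-- An exponent supported on `{i}` is a multiple of `eᵢ`. [this work] -/
theorem soloInformed_eq_single_iff (i : Fin n) (a : Fin n →₀ ℕ) (k : ℕ) :
    a = Finsupp.single i k ↔ (∀ j, j ≠ i → a j = 0) ∧ a i = k := by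
  constructor
  · rintro rfl
    exact ⟨fun j hj => Finsupp.single_eq_of_ne hj, Finsupp.single_eq_same⟩
  · rintro ⟨h, hk⟩
    ext j
    by_cases hj : j = i
    · subst hj; rw [Finsupp.single_eq_same, hk]
    · rw [Finsupp.single_eq_of_ne hj, h j hj]

omit [Algebra K ℝ] in
/-- Coefficients of the axis polynomial: `coeff k = coeff (k eᵢ) R`. [this work] -/
theorem soloInformed_coeff_edgePolyK (i : Fin n) (R : MvPolynomial (Fin n) K) (k : ℕ) :
    (soloInformedEdgePolyK i R).coeff k = MvPolynomial.coeff (Finsupp.single i k) R := by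
  classical
  conv_lhs => rw [R.as_sum]
  unfold soloInformedEdgePolyK
  rw [map_sum, Polynomial.finsetSum_coeff]
  have hterm : ∀ a ∈ R.support,
      (MvPolynomial.aeval (fun j => if j = i then Polynomial.X else (0 : Polynomial K))
        (MvPolynomial.monomial a (MvPolynomial.coeff a R))).coeff k =
      if a = Finsupp.single i k then MvPolynomial.coeff a R else 0 := by
    intro a _
    have h := soloInformed_edgePolyK_monomial (K := K) i a (MvPolynomial.coeff a R)
    unfold soloInformedEdgePolyK at h
    rw [h]
    by_cases hsupp : ∀ j, j ≠ i → a j = 0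
    · rw [if_pos hsupp, Polynomial.coeff_C_mul_X_pow]
      by_cases hk : k = a i
      · rw [if_pos hk, if_pos ((soloInformed_eq_single_iff i a k).2 ⟨hsupp, hk.symm⟩)]
      · rw [if_neg hk, if_neg (fun h' => hk ((soloInformed_eq_single_iff i a k).1 h').2.symm)]
    · rw [if_neg hsupp, Polynomial.coeff_zero,
        if_neg (fun h' => hsupp ((soloInformed_eq_single_iff i a k).1 h').1)]
  rw [Finset.sum_congr rfl hterm, Finset.sum_ite_eq']
  split_ifs with h
  · rfl
  · exact (MvPolynomial.notMem_support_iff.1 h).symm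

omit [Algebra K ℝ] in
/-- The axis polynomial is non-zero as soon as `R` has a monomial supported on the axis.
[this work] -/
theorem soloInformed_edgePolyK_ne_zero (i : Fin n) {R : MvPolynomial (Fin n) K} {k : ℕ}
    (h : MvPolynomial.coeff (Finsupp.single i k) R ≠ 0) : soloInformedEdgePolyK i R ≠ 0 := by
  intro h0
  apply h
  rw [← soloInformed_coeff_edgePolyK, h0, Polynomial.coeff_zero]

/-- **Finitely many zeros on an axis.**  If the axis polynomial is non-zero, `R` has finitely many
zeros on the `i`-th coordinate axis. [this work] -/
theorem soloInformed_finite_axisZerosK (i : Fin n) {R : MvPolynomial (Fin n) K}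
    (h : soloInformedEdgePolyK i R ≠ 0) :
    {t : ℝ | (MvPolynomial.aeval (fun j => if j = i then t else (0 : ℝ)) R : ℝ) = 0}.Finite := by
  have hp : (soloInformedEdgePolyK i R).map (algebraMap K ℝ) ≠ 0 := by
    rwa [Ne, Polynomial.map_eq_zero_iff (algebraMap K ℝ).injective]
  refine (Polynomial.finite_setOf_isRoot hp).subset fun t ht => ?_
  rw [Set.mem_setOf_eq, Polynomial.IsRoot, Polynomial.eval_map_algebraMap,
    soloInformed_aeval_edgePolyK]
  exact ht

/-! ### Two variables: the stripped polynomial has an isolated zero at the vertex -/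

omit [Algebra K ℝ] in
/-- In two variables the stripped polynomial of `Q ≠ 0` has non-zero axis polynomials.
[this work] -/
theorem soloInformed_edgePolyK_stripK_ne_zero {Q : MvPolynomial (Fin 2) K} (hQ : Q ≠ 0)
    (i : Fin 2) :
    soloInformedEdgePolyK i (soloInformedStripK Q (soloInformedMinExpK Q)) ≠ 0 := by
  -- the other index
  obtain ⟨i', hi', hii'⟩ : ∃ i' : Fin 2, i' ≠ i ∧ ∀ j : Fin 2, j ≠ i → j = i' := by
    fin_cases i
    · exact ⟨1, by decide, fun j hj => by fin_cases j <;> simp_all⟩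
    · exact ⟨0, by decide, fun j hj => by fin_cases j <;> simp_all⟩
  obtain ⟨e', he', he'0⟩ := soloInformed_exists_support_stripK_zero hQ i'
  have hsingle : e' = Finsupp.single i (e' i) :=
    (soloInformed_eq_single_iff i e' (e' i)).2 ⟨fun j hj => by rw [hii' j hj]; exact he'0, rfl⟩
  refine soloInformed_edgePolyK_ne_zero i (k := e' i) ?_
  rw [← hsingle]
  exact MvPolynomial.mem_support_iff.1 he'

/-- Below the positive elements of a finite set of reals there is room: some `η ∈ (0, 1]` is
smaller than every positive element. [this work] -/
theorem soloInformed_exists_pos_lt_of_finite {Z : Set ℝ} (hZ : Z.Finite) :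
    ∃ η : ℝ, 0 < η ∧ η ≤ 1 ∧ ∀ t ∈ Z, 0 < t → η < t := by
  induction Z, hZ using Set.Finite.induction_on with
  | empty => exact ⟨1, one_pos, le_rfl, fun t ht => absurd ht (Set.notMem_empty t)⟩
  | @insert a s _ _ ih =>
    obtain ⟨η, hη, hη1, hs⟩ := ih
    by_cases ha : 0 < a
    · refine ⟨min η (a / 2), lt_min hη (by linarith), (min_le_left _ _).trans hη1, ?_⟩
      rintro t (rfl | ht) htpos
      · exact lt_of_le_of_lt (min_le_right _ _) (by linarith)
      · exact lt_of_le_of_lt (min_le_left _ _) (hs t ht htpos)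
    · refine ⟨η, hη, hη1, ?_⟩
      rintro t (rfl | ht) htpos
      · exact absurd htpos ha
      · exact hs t ht htpos

/-- A point of the closed square with a vanishing coordinate lies on an axis. [this work] -/
theorem soloInformed_eq_axisPoint_of_apply_eq_zero {y : Fin 2 → ℝ} {i i' : Fin 2}
    (hall : ∀ j : Fin 2, j ≠ i → j = i') (hy : y i' = 0) :
    y = fun j => if j = i then y i else 0 := by
  funext j
  by_cases hj : j = i
  · rw [if_pos hj, hj]
  · rw [if_neg hj, hall j hj, hy]

/-- **Isolated vertex zero.**  In two variables: if `Q ≠ 0` has no zero on the open square, its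
stripped part `R = Q / x^m` (`m` the least exponent) has no zero `y ≠ 0` in the closed square
with both coordinates `< η`, for some `η > 0`. [this work] -/
theorem soloInformed_stripK_isolated_zero {Q : MvPolynomial (Fin 2) K} (hQ0 : Q ≠ 0)
    (hQ : ∀ x ∈ soloInformedOpenCube 2, (MvPolynomial.aeval x Q : ℝ) ≠ 0) :
    ∃ η > (0 : ℝ), ∀ y ∈ soloInformedCube 2, (∀ j, y j < η) → y ≠ 0 →
      (MvPolynomial.aeval y (soloInformedStripK Q (soloInformedMinExpK Q)) : ℝ) ≠ 0 := by
  set R := soloInformedStripK Q (soloInformedMinExpK Q) with hR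
  have hm : ∀ e ∈ Q.support, soloInformedMinExpK Q ≤ e := fun e he => soloInformed_minExpK_le he
  -- the finitely many axis zeros of `R`
  have hfin : ({t : ℝ | (MvPolynomial.aeval (fun j => if j = (0 : Fin 2) then t else (0 : ℝ)) R : ℝ)
      = 0} ∪ {t : ℝ | (MvPolynomial.aeval (fun j => if j = (1 : Fin 2) then t else (0 : ℝ)) R : ℝ)
      = 0}).Finite :=
    (soloInformed_finite_axisZerosK 0 (soloInformed_edgePolyK_stripK_ne_zero hQ0 0)).union
      (soloInformed_finite_axisZerosK 1 (soloInformed_edgePolyK_stripK_ne_zero hQ0 1))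
  obtain ⟨η, hη, hη1, hgap⟩ := soloInformed_exists_pos_lt_of_finite hfin
  refine ⟨η, hη, fun y hy hlt hy0 hRy => ?_⟩
  -- `y` is not in the open square, so a coordinate vanishes (the coordinates are `< η ≤ 1`)
  have hcoord : y 0 = 0 ∨ y 1 = 0 := by
    by_contra hne
    push Not at hne
    refine soloInformed_aeval_stripK_ne_zero Q hm (hQ y fun j => ?_) hRy
    refine ⟨lt_of_le_of_ne (hy j).1 ?_, lt_of_lt_of_le (hlt j) hη1⟩
    fin_cases j
    · exact fun h => hne.1 h.symm
    · exact fun h => hne.2 h.symm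
  rcases hcoord with h0 | h1
  · -- `y = (0, t)` lies on the axis of coordinate `1`
    have hyt : y = fun j => if j = (1 : Fin 2) then y 1 else 0 :=
      soloInformed_eq_axisPoint_of_apply_eq_zero (i := 1) (i' := 0)
        (fun j hj => by fin_cases j <;> simp_all) h0
    have ht0 : 0 < y 1 := by
      refine lt_of_le_of_ne (hy 1).1 fun h => hy0 ?_
      funext j; fin_cases j
      · exact h0
      · exact h.symm
    have hmem : y 1 ∈ {t : ℝ | (MvPolynomial.aeval (fun j => if j = (0 : Fin 2) then t else (0:ℝ)) R
        : ℝ) = 0} ∪ {t : ℝ | (MvPolynomial.aeval (fun j => if j = (1 : Fin 2) then t else (0:ℝ)) R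
        : ℝ) = 0} := Or.inr (by rw [Set.mem_setOf_eq, ← hyt]; exact hRy)
    exact absurd (hlt 1) (not_lt.2 (hgap _ hmem ht0).le)
  · have hyt : y = fun j => if j = (0 : Fin 2) then y 0 else 0 :=
      soloInformed_eq_axisPoint_of_apply_eq_zero (i := 0) (i' := 1)
        (fun j hj => by fin_cases j <;> simp_all) h1
    have ht0 : 0 < y 0 := by
      refine lt_of_le_of_ne (hy 0).1 fun h => hy0 ?_
      funext j; fin_cases j
      · exact h.symm
      · exact h1
    have hmem : y 0 ∈ {t : ℝ | (MvPolynomial.aeval (fun j => if j = (0 : Fin 2) then t else (0:ℝ)) R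
        : ℝ) = 0} ∪ {t : ℝ | (MvPolynomial.aeval (fun j => if j = (1 : Fin 2) then t else (0:ℝ)) R
        : ℝ) = 0} := Or.inl (by rw [Set.mem_setOf_eq, ← hyt]; exact hRy)
    exact absurd (hlt 0) (not_lt.2 (hgap _ hmem ht0).le)

end Summit.KontsevichZagierPeriods.KontsevichZagierPeriods.Theorems
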